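import Literature.NumberTheory.Automorphic.SymplecticSimilitudeHeckeTriangularProducts
import Literature.NumberTheory.Automorphic.SatakeTransformIwasawaCentral
import Literature.NumberTheory.Automorphic.GLnSphericalHeckeAlgebraStructure
import HarnessLib

/-!
# The Hecke algebra `ℋ(GSp_{2n}(K), GSp_{2n}(𝒪); R)` is `R[X_0, …, X_n][X_n⁻¹]` over EVERY commutative ring
# (Satake 1963; Andrianov–Zhuravlev Ch. 3 Thm. 3.30; Cartier 1979 Thm. 4.1)

[topic NumberTheory/Automorphic] — lane `lit-hodgefound`, seat p11, generation 43, self-proposed theorem-only row g43-#11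
(the `GSp_{2n}` analogue of `SymplecticHeckeAlgebraStructure` (g43-#8) and `GLnSphericalHeckeAlgebraStructure` (g42-#4), on
top of the unitriangular products of g43-#10 `SymplecticSimilitudeHeckeTriangularProducts`).

## The print

`G = GSp_{2n}(K)`, `K₀ = GSp_{2n}(𝒪)`, Cartan representatives `t(m, a) = diag(ϖ^m ϖ^{a}; ϖ^{-a})`, `a` antitone,
`m + 2aᵢ ≥ 0` (`n ≥ 1`).  Andrianov–Zhuravlev, Ch. 3 §3.3 Thm. 3.30: the local Hecke ring of the symplectic group is generated
by `T(p) = t(1; 0ⁿ)`, `T_i(p²)` (`1 ≤ i ≤ n - 1`; the double cosets of `diag(1_{n-i}, p 1_i; p² 1_{n-i}, p 1_i)`, here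
`t(2; 0^{n-i}, (-1)^{i}) = h_{n-i-1}`) and `[p]^{±1} = (ϖ·1)^{±1}`, which are algebraically independent; Cartier §IV Thm. 4.1
/ Cor. 4.2 (Satake isomorphism, unramified characters); Macdonald Ch. V (2.5), (2.7) for the `GL_n` pattern
«`H(G, K) = H(G⁺, K)[c⁻¹]`».  INTEGRALLY: the integral cone `D_int = {(m, a) : a antitone, m + 2aᵢ ≥ 0, a_0 ≤ 0}` is the free
commutative monoid on `h_r = (2; 1^{r+1} 0^{n-r-1} - 1)` (`r ≤ n - 2`), `h_{n-1} = (1; 0ⁿ)`, `h_n = z = (2; -1ⁿ) = ϖ·1`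
(`(m, a) = Σ_{r ≤ n-2} (a_r - a_{r+1}) h_r + (m + 2a_{n-1}) h_{n-1} + (-a_0) z`), every `(m, a)` is `(m, a) + a_0⁺ z` shifted
back by the central unit `z⁻¹ = t(-2; 1ⁿ)`, and the multiplication table in the basis `T_{t(m,a)}` is unitriangular with the
same multiplier exponent (g43-#10) — so over ANY commutative ring `R`,
`ℋ(GSp_{2n}(K), GSp_{2n}(𝒪); R) = R[T_{h_0}, …, T_{h_n}][T_{h_n}⁻¹] ≅ R[X_0, …, X_n][X_n⁻¹]`.

## What is formalised (kernel path: theorems only, no new definitions, no named facts)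

Generators indexed by `r : Fin (n + 1)`: `m_r = if r + 1 = n then 1 else 2`, `a_r(i) = 𝟙_{i ≤ r} - (if r = n then 2 else 1)`,
`T_{h_r} = T_{t(m_r, a_r)}`; `T_{z⁻¹} = T_{t(-2; 1ⁿ)}`.
* §1 `dominant_gen`, `one_le_top_gen`, **`injective_sum_nsmul_top_gen`** (the exponents `Σ_r α_r (m_r + a_r, m_r)` of the
  ordered monomials are distinct).
* §2 (`z = ϖ·1` is central: the tree's `SatakeTransformIwasawaCentral`) `similitudeTorusElt_two_neg_one_mul_neg_two_one`, `isMulCommutative_heckeAlgebra_symplecticSimilitudeInt` (Gelfand pair),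
  **`doubleCosetOperator_z_mul_zinv`** / `doubleCosetOperator_zinv_mul_z` (`T_z T_{z⁻¹} = 1`, Shimura Prop. 3.17),
  `pow_doubleCosetOperator_z_mul` (`T_z^j T_{t(m,a)} = T_{t(m+2j, a-j)}`).
* §3 `forall_sum_ite_lt_le_and_coeff_twist_similitudeSatakeTransform_one_monomial` (twisted bottoms `Σ_r α_r ψ(m_r + a_r, m_r)` in
  `ℤ^{n+2}`, coefficient `1`, by the `ψ`-device of g43-#10), `injective_sum_nsmul_psi_top_gen`,
  **`linearIndependent_monomials_similitude`** (any `R`), **`algebraicIndependent_doubleCosetOperator_gen_similitude`** (any `R`).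
* §4 GENERATION on the integral cone by strong induction on the potential `Σ_{s ≤ n} Σ_{i<s} (m + a_i) ≥ 0`
  (`eq_zero_iff_lt_card_filter_eq_zero`, `potential_nonneg_of_apply_zero_nonpos`, `potential_lt_of_forall_one_le_sub`,
  `potential_lt_of_lower_similitude`, **`doubleCosetOperator_mem_adjoin_gen_of_apply_zero_nonpos`**: peel `h_{n-1}` while
  `m + 2a_{n-1} > 0`, else `z` while `a_0 < 0`, else `h_r` with `r + 1 = #{i : a_i = 0}`; lower terms stay integral since
  `b_0 ≤ a_0` is read off the head sum of length `1`).
* §5 `pow_doubleCosetOperator_zinv_mul_pow_z`, **`doubleCosetOperator_mem_adjoin_insert_similitude`** (all `(m, a)`),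
  **`adjoin_insert_doubleCosetOperator_gen_eq_top_similitude`** (`ℋ = R[T_{h_r}, T_{z⁻¹}]`).
* §6 THE STRUCTURE THEOREM **`exists_algEquiv_heckeAlgebra_symplecticSimilitudeInt_localization`**
  (`ℋ ≃ₐ[R] Localization.Away (X_n) (MvPolynomial (Fin (n+1)) R)`, inverse `X_r ↦ T_{h_r}`, `X_n⁻¹ ↦ T_{z⁻¹}`); corollaries
  `isDomain_heckeAlgebra_symplecticSimilitudeInt_of_isDomain`, **`exists_equiv_algHom_heckeAlgebra_symplecticSimilitudeInt`**
  (`Hom_{R-alg}(ℋ, A) ≃ {t ∈ A^{n+1} : t_n ∈ Aˣ}` — the unramified characters / Satake parameters of `GSp_{2n}` over any `R`),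
  `algHom_heckeAlgebra_symplecticSimilitudeInt_ext`.
Not formalised here: the identification of the image of the Satake transform with the Weyl-group invariants.

## References
* [cite: AndrianovZhuravlev1995, Ch. 3 §3 Lemma 3.6, Thm. 3.7; §3.3 Thm. 3.30] — A. N. Andrianov, V. G. Zhuravlev, Modular forms
  and Hecke operators, Transl. Math. Monogr. 145, AMS 1995.
* [cite: CartierCorvallis1979, §IV Thm. 4.1 and its proof (b)–(c), Cor. 4.2] — P. Cartier, Representations of p-adic groups: a
  survey, Proc. Sympos. Pure Math. 33 (1979), part 1, 111–155.
* [cite: Macdonald1995, Ch. I §1; Ch. II (2.3); Ch. V (2.5)–(2.7), §3 (3.2)] — I. G. Macdonald, Symmetric functions and Hall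
  polynomials, 2nd ed., 1995.
* [cite: ShimuraIATAF1971, Prop. 3.17, Thm. 3.20] — G. Shimura, Introduction to the arithmetic theory of automorphic functions, 1971.
* [cite: Tits1979, §3.3.3] — J. Tits, Reductive groups over local fields, Proc. Sympos. Pure Math. 33 (1979), part 1.
-/

noncomputable section

open scoped Valued WithZero MatrixGroups
open Matrix MulAction Finset

namespace Literature.NumberTheory.Automorphic.SymplecticCartan

open Literature.NumberTheory.Automorphic.CartanUnique Literature.NumberTheory.Automorphic.HermitianLattice

variable {K : Type*} [Field K] [Valued K ℤᵐ⁰] {ϖ : K} {n : ℕ} {R : Type*} [CommRing R]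

/-! ## §1 The integral generators `h_r = t(m_r, a_r)`, `r = 0, …, n`: bookkeeping -/

omit [Valued K ℤᵐ⁰] in
/-- The generator data are dominant: `a_r` antitone and `m_r + 2 a_{r,i} ≥ 0`. [cite: AndrianovZhuravlev1995, Ch. 3 §3.3 Thm. 3.30] -/
theorem dominant_gen [NeZero n] (r : Fin (n + 1)) :
    Antitone (fun i : Fin n => (if (i : ℕ) ≤ (r : ℕ) then (1 : ℤ) else 0) - (if (r : ℕ) = n then 2 else 1)) ∧
      ∀ i : Fin n, 0 ≤ (if (r : ℕ) + 1 = n then (1 : ℤ) else 2) +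
        2 * ((if (i : ℕ) ≤ (r : ℕ) then (1 : ℤ) else 0) - (if (r : ℕ) = n then 2 else 1)) := by
  refine ⟨fun i j hij => ?_, fun i => ?_⟩
  · have hij' := Fin.le_iff_val_le_val.1 hij
    simp only
    split_ifs <;> omega
  · have hi := i.isLt
    have hr := r.isLt
    split_ifs <;> omega

omit [Valued K ℤᵐ⁰] in
/-- The top exponent `m_r + a_r` of a generator is `≥ 1` entrywise (`1 + 𝟙_{i ≤ r}` for `r ≤ n - 2`, `1` for `r = n - 1, n`).
[cite: AndrianovZhuravlev1995, Ch. 3 §3.3 Thm. 3.30] -/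
theorem one_le_top_gen [NeZero n] (r : Fin (n + 1)) (i : Fin n) :
    1 ≤ (if (r : ℕ) + 1 = n then (1 : ℤ) else 2) +
      ((if (i : ℕ) ≤ (r : ℕ) then (1 : ℤ) else 0) - (if (r : ℕ) = n then 2 else 1)) := by
  have hi := i.isLt
  have hr := r.isLt
  split_ifs <;> omega

omit [Valued K ℤᵐ⁰] in
/-- The top exponent of `h_r` at the last index `n - 1` is `1`. [folklore] -/
private theorem top_gen_last [NeZero n] (r : Fin (n + 1)) :
    (if (r : ℕ) + 1 = n then (1 : ℤ) else 2) + ((if n - 1 ≤ (r : ℕ) then (1 : ℤ) else 0) - (if (r : ℕ) = n then 2 else 1)) = 1 := by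
  have hr := r.isLt
  split_ifs <;> omega

omit [Valued K ℤᵐ⁰] in
/-- Consecutive differences of the top exponent of `h_r`: `top_{r,k} - top_{r,k+1} = 𝟙_{r = k}` (`k + 1 < n`). [folklore] -/
private theorem top_gen_sub_succ [NeZero n] (r : Fin (n + 1)) (k : ℕ) (hk : k + 1 < n) :
    ((if (r : ℕ) + 1 = n then (1 : ℤ) else 2) + ((if k ≤ (r : ℕ) then (1 : ℤ) else 0) - (if (r : ℕ) = n then 2 else 1))) -
      ((if (r : ℕ) + 1 = n then (1 : ℤ) else 2) + ((if k + 1 ≤ (r : ℕ) then (1 : ℤ) else 0) - (if (r : ℕ) = n then 2 else 1))) =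
      if (r : ℕ) = k then 1 else 0 := by
  have hr := r.isLt
  split_ifs <;> omega

omit [Valued K ℤᵐ⁰] in
/-- **The exponents of the ordered monomials are distinct**: `α ↦ ∑_r α_r (m_r + a_r, m_r)` is injective on `ℕ^{n+1}`
(consecutive differences of the first coordinate give `α_r` for `r ≤ n - 2`, its last entry gives `∑_r α_r`, and the
multiplier exponent `2 ∑_r α_r - α_{n-1}` then gives `α_{n-1}` and `α_n`).
[cite: AndrianovZhuravlev1995, Ch. 3 §3.3 Thm. 3.30] [cite: Macdonald1995, Ch. V (2.7)] -/
theorem injective_sum_nsmul_top_gen [NeZero n] :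
    Function.Injective fun α : Fin (n + 1) → ℕ => ∑ r : Fin (n + 1), α r •
      ((fun i : Fin n => (if (r : ℕ) + 1 = n then (1 : ℤ) else 2) +
          ((if (i : ℕ) ≤ (r : ℕ) then (1 : ℤ) else 0) - (if (r : ℕ) = n then 2 else 1))),
        (if (r : ℕ) + 1 = n then (1 : ℤ) else 2)) := by
  intro α β h
  have hn := Nat.pos_of_ne_zero (NeZero.ne n)
  have h1 := congrArg Prod.fst h
  have h2 := congrArg Prod.snd h
  simp only [Prod.fst_sum, Prod.snd_sum, Prod.smul_fst, Prod.smul_snd] at h1 h2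
  -- entrywise form of the first coordinate
  have hentry : ∀ i : Fin n, (∑ r : Fin (n + 1), (α r : ℤ) * ((if (r : ℕ) + 1 = n then (1 : ℤ) else 2) +
      ((if (i : ℕ) ≤ (r : ℕ) then (1 : ℤ) else 0) - (if (r : ℕ) = n then 2 else 1)))) =
      ∑ r : Fin (n + 1), (β r : ℤ) * ((if (r : ℕ) + 1 = n then (1 : ℤ) else 2) +
      ((if (i : ℕ) ≤ (r : ℕ) then (1 : ℤ) else 0) - (if (r : ℕ) = n then 2 else 1))) := fun i => by
    have h := congrFun h1 i
    rw [Finset.sum_apply, Finset.sum_apply] at h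
    simp only [Pi.smul_apply] at h
    simpa only [nsmul_eq_mul] using h
  have h2' : (∑ r : Fin (n + 1), (α r : ℤ) * (if (r : ℕ) + 1 = n then (1 : ℤ) else 2)) =
      ∑ r : Fin (n + 1), (β r : ℤ) * (if (r : ℕ) + 1 = n then (1 : ℤ) else 2) := by
    simpa only [nsmul_eq_mul] using h2
  -- (1) `α_r = β_r` for `r + 1 < n`: consecutive differences
  have hlow : ∀ r : Fin (n + 1), (r : ℕ) + 1 < n → (α r : ℤ) = β r := fun r hr => by
    have hd := congrArg₂ (· - ·) (hentry ⟨r, by omega⟩) (hentry ⟨(r : ℕ) + 1, hr⟩)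
    simp only [← Finset.sum_sub_distrib, ← mul_sub] at hd
    have hδ : ∀ γ : Fin (n + 1) → ℕ, (∑ r' : Fin (n + 1), (γ r' : ℤ) *
        (((if (r' : ℕ) + 1 = n then (1 : ℤ) else 2) + ((if (r : ℕ) ≤ (r' : ℕ) then (1 : ℤ) else 0) - (if (r' : ℕ) = n then 2 else 1))) -
          ((if (r' : ℕ) + 1 = n then (1 : ℤ) else 2) +
            ((if (r : ℕ) + 1 ≤ (r' : ℕ) then (1 : ℤ) else 0) - (if (r' : ℕ) = n then 2 else 1))))) = γ r := fun γ => by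
      rw [Finset.sum_eq_single r (fun r' _ hr' => by
          rw [top_gen_sub_succ r' (r : ℕ) hr, if_neg (fun h => hr' (Fin.ext h)), mul_zero])
        (fun h => absurd (Finset.mem_univ _) h), top_gen_sub_succ r (r : ℕ) hr, if_pos rfl, mul_one]
    rwa [hδ, hδ] at hd
  -- (2) `∑_r α_r = ∑_r β_r`: the last entry of the first coordinate
  have hsum : (∑ r : Fin (n + 1), (α r : ℤ)) = ∑ r : Fin (n + 1), (β r : ℤ) := by
    have h := hentry ⟨n - 1, Nat.sub_lt hn Nat.one_pos⟩
    simp only [top_gen_last, mul_one] at h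
    exact h
  -- (3) the multiplier exponent: `∑_r α_r m_r = 2 ∑_r α_r - α_{n-1}`
  have hM : ∀ γ : Fin (n + 1) → ℕ, (∑ r : Fin (n + 1), (γ r : ℤ) * (if (r : ℕ) + 1 = n then (1 : ℤ) else 2)) =
      2 * (∑ r : Fin (n + 1), (γ r : ℤ)) - γ ⟨n - 1, by omega⟩ := fun γ => by
    have h : ∀ r : Fin (n + 1), (γ r : ℤ) * (if (r : ℕ) + 1 = n then (1 : ℤ) else 2) =
        2 * (γ r : ℤ) - if r = ⟨n - 1, by omega⟩ then (γ r : ℤ) else 0 := fun r => by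
      by_cases hr : (r : ℕ) + 1 = n
      · rw [if_pos hr, if_pos (Fin.ext (show (r : ℕ) = n - 1 by omega))]; ring
      · rw [if_neg hr, if_neg (fun h => hr (by rw [h]; show n - 1 + 1 = n; omega))]; ring
    simp_rw [h]
    rw [Finset.sum_sub_distrib, ← Finset.mul_sum, Finset.sum_ite_eq' Finset.univ, if_pos (Finset.mem_univ _)]
  have hn1 : (α ⟨n - 1, by omega⟩ : ℤ) = β ⟨n - 1, by omega⟩ := by
    have h := h2'
    rw [hM, hM, hsum] at h
    linarith
  -- (4) all `castSucc` entries agree, hence the last one too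
  have hcast : ∀ r : Fin n, (α r.castSucc : ℤ) = β r.castSucc := fun r => by
    by_cases hr : (r : ℕ) + 1 < n
    · exact hlow r.castSucc (by rw [Fin.val_castSucc]; exact hr)
    · have hr'' := r.isLt
      have hr' : r.castSucc = ⟨n - 1, by omega⟩ := Fin.ext (by rw [Fin.val_castSucc]; show (r : ℕ) = n - 1; omega)
      rw [hr']
      exact hn1
  have hlast : (α (Fin.last n) : ℤ) = β (Fin.last n) := by
    rw [Fin.sum_univ_castSucc, Fin.sum_univ_castSucc, Finset.sum_congr rfl fun r _ => hcast r] at hsum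
    linarith
  funext r
  refine Fin.lastCases ?_ (fun r => ?_) r
  · exact_mod_cast hlast
  · exact_mod_cast hcast r

/-! ## §2 The central element `z = t(2, -1) = ϖ·1` and its inverse `z⁻¹ = t(-2, 1)` -/

omit [Valued K ℤᵐ⁰] in
/-- `z · z⁻¹ = 1` on torus elements: `t(2, -1) t(-2, 1) = 1`. [cite: AndrianovZhuravlev1995, Ch. 3 §3 Lemma 3.6] -/
theorem similitudeTorusElt_two_neg_one_mul_neg_two_one (hϖ0 : ϖ ≠ 0) :
    (similitudeTorusElt hϖ0 2 (fun _ : Fin n => (-1 : ℤ)) : symplecticSimilitudeGroup (Fin n) K) *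
        similitudeTorusElt hϖ0 (-2) (fun _ : Fin n => (1 : ℤ)) = 1 := by
  rw [similitudeTorusElt_mul, show (2 : ℤ) + -2 = 0 by norm_num,
    show ((fun _ : Fin n => (-1 : ℤ)) + fun _ : Fin n => (1 : ℤ)) = 0 from funext fun _ => by simp, similitudeTorusElt_zero]

variable [NeZero n] [IsHeckeTriple (⊤ : Submonoid (symplecticSimilitudeGroup (Fin n) K)) (symplecticSimilitudeInt (Fin n) K)
  (symplecticSimilitudeInt (Fin n) K)]

omit [NeZero n] in
/-- `T_{t(m,a)}` depends only on `(m, a)`. [folklore] -/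
private theorem doubleCosetOperator_torusElt_congr (hϖ : Valued.v ϖ = WithZero.exp (-1 : ℤ)) {m m' : ℤ} {a a' : Fin n → ℤ}
    (hm : m = m') (ha : a = a') :
    heckeAlgebra.doubleCosetOperator (k := R) (symplecticSimilitudeInt (Fin n) K)
        (similitudeTorusElt (uniformizer_ne_zero hϖ) m a : symplecticSimilitudeGroup (Fin n) K) =
      heckeAlgebra.doubleCosetOperator (k := R) (symplecticSimilitudeInt (Fin n) K)
        (similitudeTorusElt (uniformizer_ne_zero hϖ) m' a' : symplecticSimilitudeGroup (Fin n) K) := by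
  subst hm ha
  rfl

omit [NeZero n] [IsHeckeTriple (⊤ : Submonoid (symplecticSimilitudeGroup (Fin n) K)) (symplecticSimilitudeInt (Fin n) K)
  (symplecticSimilitudeInt (Fin n) K)] in
/-- The Hecke algebra `ℋ(GSp_{2n}(K), GSp_{2n}(𝒪); k)` is commutative, as an `IsMulCommutative` statement (Gelfand's trick,
`isGelfandPair_symplecticSimilitudeInt`). [cite: AndrianovZhuravlev1995, Ch. 3 §3 Thm. 3.7] [cite: Tits1979, §3.3.3] -/
theorem isMulCommutative_heckeAlgebra_symplecticSimilitudeInt (hϖ : Valued.v ϖ = WithZero.exp (-1 : ℤ)) (k : Type*)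
    [CommRing k] : IsMulCommutative (heckeAlgebra k (symplecticSimilitudeGroup (Fin n) K) (symplecticSimilitudeInt (Fin n) K)) :=
  ⟨⟨isGelfandPair_symplecticSimilitudeInt k hϖ⟩⟩

omit [NeZero n] in
/-- **`T_z T_{z⁻¹} = 1`** (`z = ϖ·1` central: `K₀ z K₀ = z K₀`, Shimura Prop. 3.17). [cite: ShimuraIATAF1971, Prop. 3.17]
[cite: AndrianovZhuravlev1995, Ch. 3 §3.3 Thm. 3.30] -/
theorem doubleCosetOperator_z_mul_zinv (hϖ : Valued.v ϖ = WithZero.exp (-1 : ℤ)) :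
    heckeAlgebra.doubleCosetOperator (k := R) (symplecticSimilitudeInt (Fin n) K)
          (similitudeTorusElt (uniformizer_ne_zero hϖ) 2 (fun _ : Fin n => (-1 : ℤ)) : symplecticSimilitudeGroup (Fin n) K) *
        heckeAlgebra.doubleCosetOperator (k := R) (symplecticSimilitudeInt (Fin n) K)
          (similitudeTorusElt (uniformizer_ne_zero hϖ) (-2) (fun _ : Fin n => (1 : ℤ)) : symplecticSimilitudeGroup (Fin n) K) = 1 := by
  rw [heckeAlgebra.doubleCosetOperator_central_mul (symplecticSimilitudeInt (Fin n) K)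
    (similitudeTorusElt_two_neg_one_central (uniformizer_ne_zero hϖ)), similitudeTorusElt_two_neg_one_mul_neg_two_one,
    heckeAlgebra.doubleCosetOperator_one]

omit [NeZero n] in
/-- **`T_{z⁻¹} T_z = 1`.** [cite: ShimuraIATAF1971, Prop. 3.17] [cite: AndrianovZhuravlev1995, Ch. 3 §3.3 Thm. 3.30] -/
theorem doubleCosetOperator_zinv_mul_z (hϖ : Valued.v ϖ = WithZero.exp (-1 : ℤ)) :
    heckeAlgebra.doubleCosetOperator (k := R) (symplecticSimilitudeInt (Fin n) K)
          (similitudeTorusElt (uniformizer_ne_zero hϖ) (-2) (fun _ : Fin n => (1 : ℤ)) : symplecticSimilitudeGroup (Fin n) K) *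
        heckeAlgebra.doubleCosetOperator (k := R) (symplecticSimilitudeInt (Fin n) K)
          (similitudeTorusElt (uniformizer_ne_zero hϖ) 2 (fun _ : Fin n => (-1 : ℤ)) : symplecticSimilitudeGroup (Fin n) K) = 1 := by
  rw [isGelfandPair_symplecticSimilitudeInt R hϖ _ _, doubleCosetOperator_z_mul_zinv hϖ]

omit [NeZero n] in
/-- **`T_z^j T_{t(m,a)} = T_{t(m + 2j, a - j)}`** (central twist, iterated). [cite: ShimuraIATAF1971, Prop. 3.17] -/
theorem pow_doubleCosetOperator_z_mul (hϖ : Valued.v ϖ = WithZero.exp (-1 : ℤ)) (j : ℕ) (m : ℤ) (a : Fin n → ℤ) :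
    heckeAlgebra.doubleCosetOperator (k := R) (symplecticSimilitudeInt (Fin n) K)
          (similitudeTorusElt (uniformizer_ne_zero hϖ) 2 (fun _ : Fin n => (-1 : ℤ)) : symplecticSimilitudeGroup (Fin n) K) ^ j *
        heckeAlgebra.doubleCosetOperator (k := R) (symplecticSimilitudeInt (Fin n) K)
          (similitudeTorusElt (uniformizer_ne_zero hϖ) m a : symplecticSimilitudeGroup (Fin n) K) =
      heckeAlgebra.doubleCosetOperator (k := R) (symplecticSimilitudeInt (Fin n) K)
        (similitudeTorusElt (uniformizer_ne_zero hϖ) (m + 2 * (j : ℤ)) (fun i => a i - (j : ℤ)) :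
          symplecticSimilitudeGroup (Fin n) K) := by
  induction j with
  | zero =>
    rw [pow_zero, one_mul]
    exact doubleCosetOperator_torusElt_congr hϖ (by simp) (funext fun i => by simp)
  | succ j ih =>
    rw [pow_succ', mul_assoc, ih, heckeAlgebra.doubleCosetOperator_central_mul (symplecticSimilitudeInt (Fin n) K)
      (similitudeTorusElt_two_neg_one_central (uniformizer_ne_zero hϖ)), similitudeTorusElt_mul]
    exact doubleCosetOperator_torusElt_congr hϖ (by push_cast; ring) (funext fun i => by simp only [Pi.add_apply]; push_cast; ring)

/-! ## §3 The ordered monomials `∏_r T_{h_r}^{α_r}`: twisted bottoms `∑_r α_r ψ(m_r + a_r, m_r)`, coefficient `1`; independence -/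

/-- **The twisted counting transform `N 𝒮_1` of an ordered monomial `∏_r T_{h_r}^{α_r}` is co-triangular in `ℤ^{n+2}` with
bottom `∑_r α_r ψ(m_r + a_r, m_r)` and bottom coefficient `1`** (any commutative ring `R`).
[cite: CartierCorvallis1979, §IV, proof of Thm. 4.1 (c)] [cite: AndrianovZhuravlev1995, Ch. 3 §3.3 Thm. 3.30] [cite: Macdonald1995, Ch. V (2.6)–(2.7)] -/
theorem forall_sum_ite_lt_le_and_coeff_twist_similitudeSatakeTransform_one_monomial (hϖ : Valued.v ϖ = WithZero.exp (-1 : ℤ))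
    (α : Fin (n + 1) → ℕ) :
    (∀ v, (((AddMonoidAlgebra.mapDomainAlgHom R R (LinearMap.pi (Matrix.vecCons (-LinearMap.snd ℤ (Fin n → ℤ) ℤ)
        (Matrix.vecCons ((2 : ℤ) • LinearMap.snd ℤ (Fin n → ℤ) ℤ)
          fun i : Fin n => -((LinearMap.proj i).comp (LinearMap.fst ℤ (Fin n → ℤ) ℤ)))) :
        ((Fin n → ℤ) × ℤ) →ₗ[ℤ] (Fin (n + 2) → ℤ)).toAddMonoidHom).comp (similitudeSatakeTransform hϖ (1 : Rˣ)))
          (List.ofFn fun r : Fin (n + 1) => heckeAlgebra.doubleCosetOperator (k := R) (symplecticSimilitudeInt (Fin n) K)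
            (similitudeTorusElt (uniformizer_ne_zero hϖ) (if (r : ℕ) + 1 = n then (1 : ℤ) else 2)
              (fun i : Fin n => (if (i : ℕ) ≤ (r : ℕ) then (1 : ℤ) else 0) - (if (r : ℕ) = n then 2 else 1)) :
              symplecticSimilitudeGroup (Fin n) K) ^ α r).prod).coeff v ≠ 0 →
        ∀ s : ℕ, (∑ j : Fin (n + 2), if (j : ℕ) < s then
            (∑ r : Fin (n + 1), α r • (LinearMap.pi (Matrix.vecCons (-LinearMap.snd ℤ (Fin n → ℤ) ℤ)
        (Matrix.vecCons ((2 : ℤ) • LinearMap.snd ℤ (Fin n → ℤ) ℤ)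
          fun i : Fin n => -((LinearMap.proj i).comp (LinearMap.fst ℤ (Fin n → ℤ) ℤ)))) :
        ((Fin n → ℤ) × ℤ) →ₗ[ℤ] (Fin (n + 2) → ℤ)) ((fun i : Fin n => (if (r : ℕ) + 1 = n then (1 : ℤ) else 2) +
              ((if (i : ℕ) ≤ (r : ℕ) then (1 : ℤ) else 0) - (if (r : ℕ) = n then 2 else 1))),
            (if (r : ℕ) + 1 = n then (1 : ℤ) else 2))) j else 0) ≤
          ∑ j : Fin (n + 2), if (j : ℕ) < s then v j else 0) ∧
      (((AddMonoidAlgebra.mapDomainAlgHom R R (LinearMap.pi (Matrix.vecCons (-LinearMap.snd ℤ (Fin n → ℤ) ℤ)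
        (Matrix.vecCons ((2 : ℤ) • LinearMap.snd ℤ (Fin n → ℤ) ℤ)
          fun i : Fin n => -((LinearMap.proj i).comp (LinearMap.fst ℤ (Fin n → ℤ) ℤ)))) :
        ((Fin n → ℤ) × ℤ) →ₗ[ℤ] (Fin (n + 2) → ℤ)).toAddMonoidHom).comp (similitudeSatakeTransform hϖ (1 : Rˣ)))
          (List.ofFn fun r : Fin (n + 1) => heckeAlgebra.doubleCosetOperator (k := R) (symplecticSimilitudeInt (Fin n) K)
            (similitudeTorusElt (uniformizer_ne_zero hϖ) (if (r : ℕ) + 1 = n then (1 : ℤ) else 2)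
              (fun i : Fin n => (if (i : ℕ) ≤ (r : ℕ) then (1 : ℤ) else 0) - (if (r : ℕ) = n then 2 else 1)) :
              symplecticSimilitudeGroup (Fin n) K) ^ α r).prod).coeff
        (∑ r : Fin (n + 1), α r • (LinearMap.pi (Matrix.vecCons (-LinearMap.snd ℤ (Fin n → ℤ) ℤ)
        (Matrix.vecCons ((2 : ℤ) • LinearMap.snd ℤ (Fin n → ℤ) ℤ)
          fun i : Fin n => -((LinearMap.proj i).comp (LinearMap.fst ℤ (Fin n → ℤ) ℤ)))) :
        ((Fin n → ℤ) × ℤ) →ₗ[ℤ] (Fin (n + 2) → ℤ)) ((fun i : Fin n => (if (r : ℕ) + 1 = n then (1 : ℤ) else 2) +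
              ((if (i : ℕ) ≤ (r : ℕ) then (1 : ℤ) else 0) - (if (r : ℕ) = n then 2 else 1))),
            (if (r : ℕ) + 1 = n then (1 : ℤ) else 2))) = 1 := by
  classical
  rw [map_list_prod, List.map_ofFn, List.prod_ofFn]
  simp only [Function.comp_def, map_pow]
  have h := forall_sum_ite_lt_le_and_coeff_prod_pow (Finset.univ : Finset (Fin (n + 1)))
    (fun r : Fin (n + 1) => ((AddMonoidAlgebra.mapDomainAlgHom R R (LinearMap.pi (Matrix.vecCons (-LinearMap.snd ℤ (Fin n → ℤ) ℤ)
        (Matrix.vecCons ((2 : ℤ) • LinearMap.snd ℤ (Fin n → ℤ) ℤ)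
          fun i : Fin n => -((LinearMap.proj i).comp (LinearMap.fst ℤ (Fin n → ℤ) ℤ)))) :
        ((Fin n → ℤ) × ℤ) →ₗ[ℤ] (Fin (n + 2) → ℤ)).toAddMonoidHom).comp
      (similitudeSatakeTransform hϖ (1 : Rˣ))) (heckeAlgebra.doubleCosetOperator (k := R) (symplecticSimilitudeInt (Fin n) K)
            (similitudeTorusElt (uniformizer_ne_zero hϖ) (if (r : ℕ) + 1 = n then (1 : ℤ) else 2)
              (fun i : Fin n => (if (i : ℕ) ≤ (r : ℕ) then (1 : ℤ) else 0) - (if (r : ℕ) = n then 2 else 1)) :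
              symplecticSimilitudeGroup (Fin n) K)))
    (fun r : Fin (n + 1) => (LinearMap.pi (Matrix.vecCons (-LinearMap.snd ℤ (Fin n → ℤ) ℤ)
        (Matrix.vecCons ((2 : ℤ) • LinearMap.snd ℤ (Fin n → ℤ) ℤ)
          fun i : Fin n => -((LinearMap.proj i).comp (LinearMap.fst ℤ (Fin n → ℤ) ℤ)))) :
        ((Fin n → ℤ) × ℤ) →ₗ[ℤ] (Fin (n + 2) → ℤ)) ((fun i : Fin n => (if (r : ℕ) + 1 = n then (1 : ℤ) else 2) +
              ((if (i : ℕ) ≤ (r : ℕ) then (1 : ℤ) else 0) - (if (r : ℕ) = n then 2 else 1))),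
            (if (r : ℕ) + 1 = n then (1 : ℤ) else 2))) α
    (fun r v hv s => by
      rw [AlgHom.comp_apply] at hv
      exact forall_headSum_psi_le_of_coeff_mapDomain_ne_zero
        (similitudeSatakeTransform_one_top_data (R := R) hϖ (dominant_gen r).1 (dominant_gen r).2).1 v hv s)
  refine ⟨h.1, ?_⟩
  rw [h.2]
  exact Finset.prod_eq_one fun r _ => by
    rw [AlgHom.comp_apply, coeff_mapDomain_psi_apply,
      (similitudeSatakeTransform_one_top_data (R := R) hϖ (dominant_gen r).1 (dominant_gen r).2).2, one_pow]

omit [IsHeckeTriple (⊤ : Submonoid (symplecticSimilitudeGroup (Fin n) K)) (symplecticSimilitudeInt (Fin n) K)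
  (symplecticSimilitudeInt (Fin n) K)] in
/-- **`α ↦ ∑_r α_r ψ(m_r + a_r, m_r)` is injective** (`ψ` injective and `injective_sum_nsmul_top_gen`).
[cite: AndrianovZhuravlev1995, Ch. 3 §3.3 Thm. 3.30] -/
theorem injective_sum_nsmul_psi_top_gen :
    Function.Injective fun α : Fin (n + 1) → ℕ => ∑ r : Fin (n + 1), α r • (LinearMap.pi (Matrix.vecCons (-LinearMap.snd ℤ (Fin n → ℤ) ℤ)
        (Matrix.vecCons ((2 : ℤ) • LinearMap.snd ℤ (Fin n → ℤ) ℤ)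
          fun i : Fin n => -((LinearMap.proj i).comp (LinearMap.fst ℤ (Fin n → ℤ) ℤ)))) :
        ((Fin n → ℤ) × ℤ) →ₗ[ℤ] (Fin (n + 2) → ℤ)) ((fun i : Fin n => (if (r : ℕ) + 1 = n then (1 : ℤ) else 2) +
              ((if (i : ℕ) ≤ (r : ℕ) then (1 : ℤ) else 0) - (if (r : ℕ) = n then 2 else 1))),
            (if (r : ℕ) + 1 = n then (1 : ℤ) else 2)) := by
  intro α β h
  refine injective_sum_nsmul_top_gen (n := n) (psi_injective ?_)
  have h' : (∑ r : Fin (n + 1), α r • (LinearMap.pi (Matrix.vecCons (-LinearMap.snd ℤ (Fin n → ℤ) ℤ)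
        (Matrix.vecCons ((2 : ℤ) • LinearMap.snd ℤ (Fin n → ℤ) ℤ)
          fun i : Fin n => -((LinearMap.proj i).comp (LinearMap.fst ℤ (Fin n → ℤ) ℤ)))) :
        ((Fin n → ℤ) × ℤ) →ₗ[ℤ] (Fin (n + 2) → ℤ)) ((fun i : Fin n => (if (r : ℕ) + 1 = n then (1 : ℤ) else 2) +
              ((if (i : ℕ) ≤ (r : ℕ) then (1 : ℤ) else 0) - (if (r : ℕ) = n then 2 else 1))),
            (if (r : ℕ) + 1 = n then (1 : ℤ) else 2))) = ∑ r : Fin (n + 1), β r • (LinearMap.pi (Matrix.vecCons (-LinearMap.snd ℤ (Fin n → ℤ) ℤ)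
        (Matrix.vecCons ((2 : ℤ) • LinearMap.snd ℤ (Fin n → ℤ) ℤ)
          fun i : Fin n => -((LinearMap.proj i).comp (LinearMap.fst ℤ (Fin n → ℤ) ℤ)))) :
        ((Fin n → ℤ) × ℤ) →ₗ[ℤ] (Fin (n + 2) → ℤ)) ((fun i : Fin n => (if (r : ℕ) + 1 = n then (1 : ℤ) else 2) +
              ((if (i : ℕ) ≤ (r : ℕ) then (1 : ℤ) else 0) - (if (r : ℕ) = n then 2 else 1))),
            (if (r : ℕ) + 1 = n then (1 : ℤ) else 2)) := h
  simp only [← map_nsmul, ← map_sum] at h'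
  exact h'

/-- **The ordered monomials `∏_r T_{h_r}^{α_r}`, `α ∈ ℕ^{n+1}`, are `R`-linearly independent in `ℋ(GSp_{2n}(K), GSp_{2n}(𝒪); R)`
for EVERY commutative ring `R`** (distinct twisted bottoms with unit coefficients).
[cite: AndrianovZhuravlev1995, Ch. 3 §3.3 Thm. 3.30] [cite: CartierCorvallis1979, §IV, proof of Thm. 4.1 (b)–(c)] -/
theorem linearIndependent_monomials_similitude (hϖ : Valued.v ϖ = WithZero.exp (-1 : ℤ)) :
    LinearIndependent R fun α : Fin (n + 1) → ℕ => (List.ofFn fun r : Fin (n + 1) => heckeAlgebra.doubleCosetOperator (k := R) (symplecticSimilitudeInt (Fin n) K)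
            (similitudeTorusElt (uniformizer_ne_zero hϖ) (if (r : ℕ) + 1 = n then (1 : ℤ) else 2)
              (fun i : Fin n => (if (i : ℕ) ≤ (r : ℕ) then (1 : ℤ) else 0) - (if (r : ℕ) = n then 2 else 1)) :
              symplecticSimilitudeGroup (Fin n) K) ^ α r).prod := by
  classical
  refine LinearIndependent.of_comp
    (((AddMonoidAlgebra.mapDomainAlgHom R R (LinearMap.pi (Matrix.vecCons (-LinearMap.snd ℤ (Fin n → ℤ) ℤ)
        (Matrix.vecCons ((2 : ℤ) • LinearMap.snd ℤ (Fin n → ℤ) ℤ)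
          fun i : Fin n => -((LinearMap.proj i).comp (LinearMap.fst ℤ (Fin n → ℤ) ℤ)))) :
        ((Fin n → ℤ) × ℤ) →ₗ[ℤ] (Fin (n + 2) → ℤ)).toAddMonoidHom).comp (similitudeSatakeTransform hϖ (1 : Rˣ))).toLinearMap) ?_
  refine linearIndependent_of_forall_sum_ite_lt_le_of_isUnit _
    (fun α : Fin (n + 1) → ℕ => ∑ r : Fin (n + 1), α r • (LinearMap.pi (Matrix.vecCons (-LinearMap.snd ℤ (Fin n → ℤ) ℤ)
        (Matrix.vecCons ((2 : ℤ) • LinearMap.snd ℤ (Fin n → ℤ) ℤ)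
          fun i : Fin n => -((LinearMap.proj i).comp (LinearMap.fst ℤ (Fin n → ℤ) ℤ)))) :
        ((Fin n → ℤ) × ℤ) →ₗ[ℤ] (Fin (n + 2) → ℤ)) ((fun i : Fin n => (if (r : ℕ) + 1 = n then (1 : ℤ) else 2) +
              ((if (i : ℕ) ≤ (r : ℕ) then (1 : ℤ) else 0) - (if (r : ℕ) = n then 2 else 1))),
            (if (r : ℕ) + 1 = n then (1 : ℤ) else 2)))
    injective_sum_nsmul_psi_top_gen (fun α v hv s => ?_) (fun α => ?_)
  · rw [Function.comp_apply, AlgHom.toLinearMap_apply] at hv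
    exact (forall_sum_ite_lt_le_and_coeff_twist_similitudeSatakeTransform_one_monomial (R := R) hϖ α).1 v hv s
  · rw [Function.comp_apply, AlgHom.toLinearMap_apply,
      (forall_sum_ite_lt_le_and_coeff_twist_similitudeSatakeTransform_one_monomial (R := R) hϖ α).2]
    exact isUnit_one

open scoped IsMulCommutative in
/-- **THE INTEGRAL GENERATORS `T_{h_0}, …, T_{h_n}` (`h_r = t(2; 1^{r+1} 0 ⋯ 0 - 1)` for `r ≤ n-2`, `h_{n-1} = t(1; 0) = diag(ϖ1, 1)`,
`h_n = z = ϖ·1`) ARE ALGEBRAICALLY INDEPENDENT OVER EVERY COMMUTATIVE RING `R`** in the commutative ring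
`ℋ(GSp_{2n}(K), GSp_{2n}(𝒪); R)` — Andrianov–Zhuravlev's `T(p), T_1(p²), …, T_{n-1}(p²), [p]`.
[cite: AndrianovZhuravlev1995, Ch. 3 §3.3 Thm. 3.30] [cite: CartierCorvallis1979, §IV Thm. 4.1] -/
theorem algebraicIndependent_doubleCosetOperator_gen_similitude (hϖ : Valued.v ϖ = WithZero.exp (-1 : ℤ)) :
    haveI := isMulCommutative_heckeAlgebra_symplecticSimilitudeInt (n := n) hϖ R
    AlgebraicIndependent R fun r : Fin (n + 1) => heckeAlgebra.doubleCosetOperator (k := R) (symplecticSimilitudeInt (Fin n) K)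
            (similitudeTorusElt (uniformizer_ne_zero hϖ) (if (r : ℕ) + 1 = n then (1 : ℤ) else 2)
              (fun i : Fin n => (if (i : ℕ) ≤ (r : ℕ) then (1 : ℤ) else 0) - (if (r : ℕ) = n then 2 else 1)) :
              symplecticSimilitudeGroup (Fin n) K) := by
  classical
  haveI := isMulCommutative_heckeAlgebra_symplecticSimilitudeInt (n := n) hϖ R
  have hlin := linearIndependent_monomials_similitude (n := n) (R := R) hϖ
  rw [algebraicIndependent_iff]
  intro P hP
  have hlin' := hlin.comp (fun d : Fin (n + 1) →₀ ℕ => (d : Fin (n + 1) → ℕ)) DFunLike.coe_injective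
  have hzero := linearIndependent_iff'ₛ.1 hlin' P.support (fun d => P.coeff d) (fun _ => 0) (by
    simp only [Function.comp_apply, zero_smul, Finset.sum_const_zero]
    rw [MvPolynomial.aeval_def, MvPolynomial.eval₂_eq'] at hP
    rw [← hP]
    refine Finset.sum_congr rfl fun d _ => ?_
    rw [Algebra.smul_def, List.prod_ofFn])
  ext d
  rw [MvPolynomial.coeff_zero]
  by_cases hdd : d ∈ P.support
  · exact hzero d hdd
  · exact MvPolynomial.notMem_support_iff.1 hdd

/-! ## §4 Generation: every `T_{t(m,a)}` is a polynomial in the `T_{h_r}` and `T_{z⁻¹}` (induction on the potential) -/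

omit [Valued K ℤᵐ⁰]
  [IsHeckeTriple (⊤ : Submonoid (symplecticSimilitudeGroup (Fin n) K)) (symplecticSimilitudeInt (Fin n) K)
  (symplecticSimilitudeInt (Fin n) K)] in
/-- For `a` antitone with `a_0 = 0`: `a_i = 0` exactly for the first `#{j : a_j = 0}` indices. [cite: Macdonald1995, Ch. I §1] -/
theorem eq_zero_iff_lt_card_filter_eq_zero {a : Fin n → ℤ} (ha : Antitone a) (h0 : a 0 = 0) (i : Fin n) :
    a i = 0 ↔ (i : ℕ) < (Finset.univ.filter fun j => a j = 0).card := by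
  have hle : ∀ j, a j ≤ 0 := fun j => (ha (Fin.zero_le j)).trans_eq h0
  constructor
  · intro hi
    have hsub : Finset.Iic i ⊆ Finset.univ.filter fun j => a j = 0 := fun j hj =>
      Finset.mem_filter.2 ⟨Finset.mem_univ _, le_antisymm (hle j) (hi.symm.trans_le (ha (Finset.mem_Iic.1 hj)))⟩
    have h := Finset.card_le_card hsub
    rw [Fin.card_Iic] at h
    omega
  · intro hi
    by_contra hne
    have hlt : a i < 0 := lt_of_le_of_ne (hle i) hne
    have hsub : (Finset.univ.filter fun j => a j = 0) ⊆ Finset.Iio i := fun j hj => by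
      rw [Finset.mem_Iio]
      by_contra hij
      have h := (Finset.mem_filter.1 hj).2
      have h' := (ha (not_lt.1 hij)).trans_lt hlt
      omega
    have h := Finset.card_le_card hsub
    rw [Fin.card_Iio] at h
    omega

omit [Valued K ℤᵐ⁰]
  [IsHeckeTriple (⊤ : Submonoid (symplecticSimilitudeGroup (Fin n) K)) (symplecticSimilitudeInt (Fin n) K)
  (symplecticSimilitudeInt (Fin n) K)] in
/-- The potential `∑_{s ≤ n} ∑_{i<s} (m + a_i)` is non-negative on the integral cone `a` antitone, `m + 2aᵢ ≥ 0`, `a_0 ≤ 0`.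
[cite: Macdonald1995, Ch. I §1] [cite: AndrianovZhuravlev1995, Ch. 3 §3.3] -/
theorem potential_nonneg_of_apply_zero_nonpos {m : ℤ} {a : Fin n → ℤ} (ha : Antitone a)
    (hm : ∀ i, 0 ≤ m + 2 * a i) (h0 : a 0 ≤ 0) :
    0 ≤ ∑ s ∈ Finset.range (n + 1), ∑ i : Fin n, if (i : ℕ) < s then (fun i => m + a i) i else 0 :=
  Finset.sum_nonneg fun _ _ => Finset.sum_nonneg fun i _ => by
    split_ifs
    · have h1 := hm i
      have h2 := (ha (Fin.zero_le i)).trans h0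
      show 0 ≤ m + a i
      linarith
    · exact le_rfl

omit [Valued K ℤᵐ⁰]
  [IsHeckeTriple (⊤ : Submonoid (symplecticSimilitudeGroup (Fin n) K)) (symplecticSimilitudeInt (Fin n) K)
  (symplecticSimilitudeInt (Fin n) K)] in
/-- Peeling off a generator (top exponent `≥ 1` entrywise) strictly lowers the potential. [cite: Macdonald1995, Ch. I §1] -/
theorem potential_lt_of_forall_one_le_sub {m m' : ℤ} {a a' : Fin n → ℤ} (h : ∀ i, 1 ≤ (m + a i) - (m' + a' i)) :
    (∑ s ∈ Finset.range (n + 1), ∑ i : Fin n, if (i : ℕ) < s then (fun i => m' + a' i) i else 0) <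
      ∑ s ∈ Finset.range (n + 1), ∑ i : Fin n, if (i : ℕ) < s then (fun i => m + a i) i else 0 := by
  refine sum_range_sum_ite_lt_lt_of_forall_le_of_ne (fun t => Finset.sum_le_sum fun i _ => ?_) fun heq => ?_
  · split_ifs
    · have hi := h i
      show m' + a' i ≤ m + a i
      linarith
    · exact le_rfl
  · have h0 : m' + a' 0 = m + a 0 := congrFun heq 0
    have h1 := h 0
    linarith

omit [Valued K ℤᵐ⁰] [NeZero n]
  [IsHeckeTriple (⊤ : Submonoid (symplecticSimilitudeGroup (Fin n) K)) (symplecticSimilitudeInt (Fin n) K)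
  (symplecticSimilitudeInt (Fin n) K)] in
/-- A strictly dominated exponent with the same multiplier exponent has strictly smaller potential. [cite: Macdonald1995, Ch. I §1] -/
theorem potential_lt_of_lower_similitude {m : ℤ} {a b : Fin n → ℤ}
    (hle : ∀ s : ℕ, (∑ i : Fin n, if (i : ℕ) < s then (fun i => m + b i) i else 0) ≤
      ∑ i : Fin n, if (i : ℕ) < s then (fun i => m + a i) i else 0) (hne : b ≠ a) :
    (∑ s ∈ Finset.range (n + 1), ∑ i : Fin n, if (i : ℕ) < s then (fun i => m + b i) i else 0) <
      ∑ s ∈ Finset.range (n + 1), ∑ i : Fin n, if (i : ℕ) < s then (fun i => m + a i) i else 0 :=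
  sum_range_sum_ite_lt_lt_of_forall_le_of_ne hle fun heq => hne (funext fun i => by
    have h : m + b i = m + a i := congrFun heq i
    linarith)

omit [Valued K ℤᵐ⁰]
  [IsHeckeTriple (⊤ : Submonoid (symplecticSimilitudeGroup (Fin n) K)) (symplecticSimilitudeInt (Fin n) K)
  (symplecticSimilitudeInt (Fin n) K)] in
/-- `∑_{i<1} f_i = f_0`. [folklore] -/
private theorem sum_ite_lt_one (f : Fin n → ℤ) : (∑ i : Fin n, if (i : ℕ) < 1 then f i else 0) = f 0 := by
  rw [Finset.sum_eq_single (0 : Fin n) (fun j _ hj => if_neg fun h => hj (Fin.ext (by rw [Fin.val_zero]; omega)))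
    (fun h => absurd (Finset.mem_univ _) h), if_pos (by rw [Fin.val_zero]; exact Nat.one_pos)]

/-- **Every integral Cartan operator `T_{t(m,a)}` (`a` antitone, `m + 2aᵢ ≥ 0`, `a_0 ≤ 0`) lies in `R[T_{h_0}, …, T_{h_n}]`**:
peel off `h_{n-1} = t(1; 0)` while `m + 2a_{n-1} > 0`, else `h_n = z` while `a_0 < 0`, else `h_r` with `r + 1 = #{a_i = 0}`;
`T_{h} T_{t((m,a) - h)} = T_{t(m,a)} + ∑_{ν < (m,a)} l_ν T_{t(ν)}` (g43-#10) with `(m,a) - h` and every `ν` integral of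
strictly smaller potential. [cite: AndrianovZhuravlev1995, Ch. 3 §3.3, proof of Thm. 3.30] [cite: CartierCorvallis1979, §IV, proof of Thm. 4.1 (c)]
[cite: Macdonald1995, Ch. V (2.7); Ch. II (2.3)] -/
theorem doubleCosetOperator_mem_adjoin_gen_of_apply_zero_nonpos (hϖ : Valued.v ϖ = WithZero.exp (-1 : ℤ)) {m : ℤ}
    {a : Fin n → ℤ} (ha : Antitone a) (hm : ∀ i, 0 ≤ m + 2 * a i) (h0 : a 0 ≤ 0) :
    heckeAlgebra.doubleCosetOperator (k := R) (symplecticSimilitudeInt (Fin n) K)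
        (similitudeTorusElt (uniformizer_ne_zero hϖ) m a : symplecticSimilitudeGroup (Fin n) K) ∈
      Algebra.adjoin R (Set.range fun r : Fin (n + 1) => heckeAlgebra.doubleCosetOperator (k := R) (symplecticSimilitudeInt (Fin n) K)
            (similitudeTorusElt (uniformizer_ne_zero hϖ) (if (r : ℕ) + 1 = n then (1 : ℤ) else 2)
              (fun i : Fin n => (if (i : ℕ) ≤ (r : ℕ) then (1 : ℤ) else 0) - (if (r : ℕ) = n then 2 else 1)) :
              symplecticSimilitudeGroup (Fin n) K)) := by
  classical
  suffices h : ∀ (N : ℕ) (m : ℤ) (a : Fin n → ℤ), Antitone a → (∀ i, 0 ≤ m + 2 * a i) → a 0 ≤ 0 →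
      (∑ s ∈ Finset.range (n + 1), ∑ i : Fin n, if (i : ℕ) < s then (fun i => m + a i) i else 0).toNat = N →
      heckeAlgebra.doubleCosetOperator (k := R) (symplecticSimilitudeInt (Fin n) K)
          (similitudeTorusElt (uniformizer_ne_zero hϖ) m a : symplecticSimilitudeGroup (Fin n) K) ∈
        Algebra.adjoin R (Set.range fun r : Fin (n + 1) => heckeAlgebra.doubleCosetOperator (k := R) (symplecticSimilitudeInt (Fin n) K)
            (similitudeTorusElt (uniformizer_ne_zero hϖ) (if (r : ℕ) + 1 = n then (1 : ℤ) else 2)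
              (fun i : Fin n => (if (i : ℕ) ≤ (r : ℕ) then (1 : ℤ) else 0) - (if (r : ℕ) = n then 2 else 1)) :
              symplecticSimilitudeGroup (Fin n) K)) from
    h _ m a ha hm h0 rfl
  intro N
  refine Nat.strong_induction_on N fun N ih => ?_
  intro m a ha hm h0 hN
  have hn := Nat.pos_of_ne_zero (NeZero.ne n)
  have hale : ∀ i, a i ≤ a 0 := fun i => ha (Fin.zero_le i)
  have halast : ∀ i, a ⟨n - 1, by omega⟩ ≤ a i := fun i => ha (Fin.le_iff_val_le_val.2 (by have := i.isLt; simp only; omega))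
  -- THE PEEL STEP: `(m, a) = (mg, ag) + (m', a')` with `(mg, ag) = h_r` a generator and `(m', a')` integral
  have step : ∀ (r : Fin (n + 1)) (mg m' : ℤ) (ag a' : Fin n → ℤ),
      mg = (if (r : ℕ) + 1 = n then (1 : ℤ) else 2) →
      ag = (fun i : Fin n => (if (i : ℕ) ≤ (r : ℕ) then (1 : ℤ) else 0) - (if (r : ℕ) = n then 2 else 1)) →
      Antitone a' → (∀ i, 0 ≤ m' + 2 * a' i) → a' 0 ≤ 0 → mg + m' = m → ag + a' = a →
      heckeAlgebra.doubleCosetOperator (k := R) (symplecticSimilitudeInt (Fin n) K)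
          (similitudeTorusElt (uniformizer_ne_zero hϖ) m a : symplecticSimilitudeGroup (Fin n) K) ∈
        Algebra.adjoin R (Set.range fun r : Fin (n + 1) => heckeAlgebra.doubleCosetOperator (k := R) (symplecticSimilitudeInt (Fin n) K)
            (similitudeTorusElt (uniformizer_ne_zero hϖ) (if (r : ℕ) + 1 = n then (1 : ℤ) else 2)
              (fun i : Fin n => (if (i : ℕ) ≤ (r : ℕ) then (1 : ℤ) else 0) - (if (r : ℕ) = n then 2 else 1)) :
              symplecticSimilitudeGroup (Fin n) K)) := by
    intro r mg m' ag a' hmg hag ha' hm' h0' hmm haa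
    subst hmg hag hmm haa
    set mg : ℤ := (if (r : ℕ) + 1 = n then (1 : ℤ) else 2) with hmg
    set ag : Fin n → ℤ := (fun i : Fin n => (if (i : ℕ) ≤ (r : ℕ) then (1 : ℤ) else 0) - (if (r : ℕ) = n then 2 else 1)) with hag
    have hgen : Antitone ag ∧ ∀ i, 0 ≤ mg + 2 * ag i := dominant_gen (n := n) r
    have hone : ∀ i, 1 ≤ mg + ag i := one_le_top_gen (n := n) r
    obtain ⟨l, hl, hprod⟩ := doubleCosetOperator_mul_eq_add_sum_similitude (R := R) hϖ hgen.1 hgen.2 ha' hm'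
    -- `T_{t(m,a)} = T_{h_r} T_{t(m',a')} + ∑_ν (-l_ν) T_{t(ν)}`
    have hca : heckeAlgebra.doubleCosetOperator (k := R) (symplecticSimilitudeInt (Fin n) K)
          (similitudeTorusElt (uniformizer_ne_zero hϖ) (mg + m') (ag + a') : symplecticSimilitudeGroup (Fin n) K) =
        heckeAlgebra.doubleCosetOperator (k := R) (symplecticSimilitudeInt (Fin n) K)
              (similitudeTorusElt (uniformizer_ne_zero hϖ) mg ag : symplecticSimilitudeGroup (Fin n) K) *
            heckeAlgebra.doubleCosetOperator (k := R) (symplecticSimilitudeInt (Fin n) K)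
              (similitudeTorusElt (uniformizer_ne_zero hϖ) m' a' : symplecticSimilitudeGroup (Fin n) K) +
          ∑ ν ∈ l.support.erase ⟨(mg + m', ag + a'), dominant_add hgen.1 hgen.2 ha' hm'⟩, (-l ν) •
            heckeAlgebra.doubleCosetOperator (k := R) (symplecticSimilitudeInt (Fin n) K)
              (similitudeTorusElt (uniformizer_ne_zero hϖ) ν.1.1 ν.1.2 : symplecticSimilitudeGroup (Fin n) K) := by
      rw [hprod, add_assoc, ← Finset.sum_add_distrib]
      exact (add_eq_left.2 (Finset.sum_eq_zero fun ν _ => by rw [← add_smul, add_neg_cancel, zero_smul])).symm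
    rw [hca]
    -- the potential of `(m, a)` is positive
    have hlt' := potential_lt_of_forall_one_le_sub (n := n) (m := mg + m') (m' := m') (a := ag + a') (a' := a')
      (fun i => by have h := hone i; simp only [Pi.add_apply]; linarith)
    have hpos := (potential_nonneg_of_apply_zero_nonpos ha' hm' h0').trans_lt hlt'
    refine Subalgebra.add_mem _ (Subalgebra.mul_mem _ ?_ ?_) (Subalgebra.sum_mem _ fun ν hν => Subalgebra.smul_mem _ ?_ _)
    · -- the generator
      exact Algebra.subset_adjoin ⟨r, rfl⟩
    · -- the peeled operator, of smaller potential
      refine ih _ ?_ m' a' ha' hm' h0' rfl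
      rw [← hN]
      exact (Int.toNat_lt_toNat hpos).2 hlt'
    · -- the lower terms
      obtain ⟨hne, hνm, hνle⟩ := hl ν hν
      have hν0 : ν.1.2 0 ≤ 0 := by
        have h1 : (fun i => ν.1.1 + ν.1.2 i) 0 ≤ (fun i => (mg + m') + (ag + a') i) 0 := by
          have h := hνle 1
          rwa [sum_ite_lt_one, sum_ite_lt_one] at h
        have h2 : (ag + a') 0 ≤ 0 := h0
        have h3 : ν.1.1 + ν.1.2 0 ≤ (mg + m') + (ag + a') 0 := h1
        rw [hνm] at h3
        linarith
      have hνne : ν.1.2 ≠ ag + a' := fun h => hne (Prod.ext hνm h)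
      refine ih _ ?_ ν.1.1 ν.1.2 ν.2.1 ν.2.2 hν0 rfl
      rw [← hN]
      refine (Int.toNat_lt_toNat hpos).2 ?_
      have hνle' : ∀ s : ℕ, (∑ i : Fin n, if (i : ℕ) < s then (fun i => (mg + m') + ν.1.2 i) i else 0) ≤
          ∑ i : Fin n, if (i : ℕ) < s then (fun i => (mg + m') + (ag + a') i) i else 0 := fun s => by
        have h := hνle s
        rw [hνm] at h
        exact h
      have h := potential_lt_of_lower_similitude hνle' hνne
      rw [← hνm] at h ⊢
      exact h
  -- the zero case
  by_cases hzero : m = 0 ∧ a = 0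
  · obtain ⟨rfl, rfl⟩ := hzero
    rw [show (0 : Fin n → ℤ) = (0 : Fin n → ℤ) from rfl, similitudeTorusElt_zero (uniformizer_ne_zero hϖ),
      heckeAlgebra.doubleCosetOperator_one]
    exact Subalgebra.one_mem _
  have hlast := hm ⟨n - 1, by omega⟩
  by_cases hT : 0 < m + 2 * a ⟨n - 1, by omega⟩
  · -- peel `h_{n-1} = t(1; 0)`
    exact step ⟨n - 1, by omega⟩ 1 (m - 1) (fun _ => 0) a (by rw [if_pos (by simp only; omega)])
      (by funext i; have hi := i.isLt; simp only; split_ifs <;> omega) ha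
      (fun i => by have h := halast i; linarith) h0 (by ring) (by funext i; simp)
  have hT0 : m + 2 * a ⟨n - 1, by omega⟩ = 0 := le_antisymm (not_lt.1 hT) hlast
  by_cases hZ : a 0 < 0
  · -- peel `h_n = z = t(2; -1)`
    exact step (Fin.last n) 2 (m - 2) (fun _ => -1) (fun i => a i + 1) (by rw [if_neg (by rw [Fin.val_last]; omega)])
      (by funext i; have hi := i.isLt; simp only [Fin.val_last]; split_ifs <;> omega)
      (fun i j hij => by have h := ha hij; show a j + 1 ≤ a i + 1; linarith) (fun i => by have h := hm i; linarith)
      (show a 0 + 1 ≤ 0 by omega) (by ring) (by funext i; simp)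
  -- peel `h_r`, `r + 1 = #{i : a_i = 0}` (`a_0 = 0`, `a_{n-1} < 0`)
  have ha0 : a 0 = 0 := le_antisymm h0 (not_lt.1 hZ)
  have hneg : a ⟨n - 1, by omega⟩ < 0 := by
    by_contra hnn
    have hl0 : a ⟨n - 1, by omega⟩ = 0 := le_antisymm ((hale _).trans h0) (not_lt.1 hnn)
    exact hzero ⟨by omega, funext fun i => le_antisymm ((hale i).trans h0) (hl0.symm.trans_le (halast i))⟩
  have hk1 : 1 ≤ (Finset.univ.filter fun j => a j = 0).card :=
    Finset.card_pos.2 ⟨0, Finset.mem_filter.2 ⟨Finset.mem_univ _, ha0⟩⟩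
  have hkn : (Finset.univ.filter fun j => a j = 0).card < n := by
    have h : (Finset.univ.filter fun j => a j = 0) ⊂ Finset.univ :=
      Finset.ssubset_iff_subset_ne.2 ⟨Finset.subset_univ _, fun h => by
        have hmem : (⟨n - 1, by omega⟩ : Fin n) ∈ Finset.univ.filter fun j => a j = 0 := h.symm ▸ Finset.mem_univ _
        exact (ne_of_lt hneg) (Finset.mem_filter.1 hmem).2⟩
    have h' := Finset.card_lt_card h
    rwa [Finset.card_univ, Fintype.card_fin] at h'
  have hiff := eq_zero_iff_lt_card_filter_eq_zero ha ha0
  exact step ⟨(Finset.univ.filter fun j => a j = 0).card - 1, by omega⟩ 2 (m - 2)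
    (fun i => if a i < 0 then -1 else 0) (fun i => if a i < 0 then a i + 1 else a i) (by rw [if_neg (by simp only; omega)])
    (by
      funext i
      have hi := hiff i
      have hi' := hale i
      rw [ha0] at hi'
      rw [if_neg (show ¬(((⟨(Finset.univ.filter fun j => a j = 0).card - 1, by omega⟩ : Fin (n + 1)) : ℕ) = n) by
        simp only; omega)]
      by_cases hai : a i < 0
      · rw [if_pos hai, if_neg (by simp only; have := hi.not; omega)]
        norm_num
      · have hai0 : a i = 0 := le_antisymm hi' (not_lt.1 hai)
        rw [if_neg hai, if_pos (by simp only; have := hi.1 hai0; omega)]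
        norm_num)
    (fun i j hij => by
      have h := ha hij
      have hi := hale i
      have hj := hale j
      rw [ha0] at hi hj
      show (if a j < 0 then a j + 1 else a j) ≤ (if a i < 0 then a i + 1 else a i)
      split_ifs <;> omega)
    (fun i => by
      have h := hm i
      have hl := halast i
      show 0 ≤ (m - 2) + 2 * (if a i < 0 then a i + 1 else a i)
      split_ifs <;> omega)
    (show (if a 0 < 0 then a 0 + 1 else a 0) ≤ 0 by rw [ha0]; norm_num) (by ring)
    (funext fun i => by simp only [Pi.add_apply]; split_ifs <;> omega)

/-! ## §5 All of `ℋ`: `T_{t(m,a)} = T_{z⁻¹}^j T_{t(m + 2j, a - j)}`; `ℋ = R[T_{h_0}, …, T_{h_n}, T_{z⁻¹}]` -/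

omit [NeZero n] in
/-- `T_{z⁻¹}^j T_z^j = 1`. [cite: ShimuraIATAF1971, Prop. 3.17] -/
theorem pow_doubleCosetOperator_zinv_mul_pow_z (hϖ : Valued.v ϖ = WithZero.exp (-1 : ℤ)) (j : ℕ) :
    heckeAlgebra.doubleCosetOperator (k := R) (symplecticSimilitudeInt (Fin n) K)
          (similitudeTorusElt (uniformizer_ne_zero hϖ) (-2) (fun _ : Fin n => (1 : ℤ)) : symplecticSimilitudeGroup (Fin n) K) ^ j *
        heckeAlgebra.doubleCosetOperator (k := R) (symplecticSimilitudeInt (Fin n) K)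
          (similitudeTorusElt (uniformizer_ne_zero hϖ) 2 (fun _ : Fin n => (-1 : ℤ)) : symplecticSimilitudeGroup (Fin n) K) ^ j = 1 := by
  induction j with
  | zero => rw [pow_zero, pow_zero, one_mul]
  | succ j ih => rw [pow_succ, pow_succ', mul_assoc, ← mul_assoc _ _ (_ ^ j), doubleCosetOperator_zinv_mul_z hϖ, one_mul, ih]

/-- **Every Cartan operator `T_{t(m,a)}` (`a` antitone, `m + 2aᵢ ≥ 0`) lies in `R[T_{h_0}, …, T_{h_n}, T_{z⁻¹}]`**:
`T_{t(m,a)} = T_{z⁻¹}^j · T_{t(m + 2j, a - j)}` with `j = max(a_0, 0)` and `t(m + 2j, a - j)` integral.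
[cite: AndrianovZhuravlev1995, Ch. 3 §3.3 Thm. 3.30] [cite: Macdonald1995, Ch. V (2.5), (2.7)] -/
theorem doubleCosetOperator_mem_adjoin_insert_similitude (hϖ : Valued.v ϖ = WithZero.exp (-1 : ℤ)) {m : ℤ} {a : Fin n → ℤ}
    (ha : Antitone a) (hm : ∀ i, 0 ≤ m + 2 * a i) :
    heckeAlgebra.doubleCosetOperator (k := R) (symplecticSimilitudeInt (Fin n) K)
        (similitudeTorusElt (uniformizer_ne_zero hϖ) m a : symplecticSimilitudeGroup (Fin n) K) ∈
      Algebra.adjoin R (insert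
        (heckeAlgebra.doubleCosetOperator (k := R) (symplecticSimilitudeInt (Fin n) K)
          (similitudeTorusElt (uniformizer_ne_zero hϖ) (-2) (fun _ : Fin n => (1 : ℤ)) : symplecticSimilitudeGroup (Fin n) K))
        (Set.range fun r : Fin (n + 1) => heckeAlgebra.doubleCosetOperator (k := R) (symplecticSimilitudeInt (Fin n) K)
            (similitudeTorusElt (uniformizer_ne_zero hϖ) (if (r : ℕ) + 1 = n then (1 : ℤ) else 2)
              (fun i : Fin n => (if (i : ℕ) ≤ (r : ℕ) then (1 : ℤ) else 0) - (if (r : ℕ) = n then 2 else 1)) :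
              symplecticSimilitudeGroup (Fin n) K))) := by
  set j : ℕ := (a 0).toNat with hj
  have hrew : heckeAlgebra.doubleCosetOperator (k := R) (symplecticSimilitudeInt (Fin n) K)
        (similitudeTorusElt (uniformizer_ne_zero hϖ) m a : symplecticSimilitudeGroup (Fin n) K) =
      heckeAlgebra.doubleCosetOperator (k := R) (symplecticSimilitudeInt (Fin n) K)
            (similitudeTorusElt (uniformizer_ne_zero hϖ) (-2) (fun _ : Fin n => (1 : ℤ)) : symplecticSimilitudeGroup (Fin n) K) ^ j *
          heckeAlgebra.doubleCosetOperator (k := R) (symplecticSimilitudeInt (Fin n) K)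
            (similitudeTorusElt (uniformizer_ne_zero hϖ) (m + 2 * (j : ℤ)) (fun i => a i - (j : ℤ)) :
              symplecticSimilitudeGroup (Fin n) K) := by
    rw [← pow_doubleCosetOperator_z_mul hϖ j m a, ← mul_assoc, pow_doubleCosetOperator_zinv_mul_pow_z hϖ j, one_mul]
  rw [hrew]
  refine Subalgebra.mul_mem _ (Subalgebra.pow_mem _ (Algebra.subset_adjoin (Set.mem_insert _ _)) j)
    (Algebra.adjoin_mono (Set.subset_insert _ _) (doubleCosetOperator_mem_adjoin_gen_of_apply_zero_nonpos hϖ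
      (fun i i' h => sub_le_sub_right (ha h) _) (fun i => by have h := hm i; linarith) ?_))
  have h0 : a 0 ≤ (j : ℤ) := Int.self_le_toNat (a 0)
  show a 0 - (j : ℤ) ≤ 0
  linarith

/-- **`ℋ(GSp_{2n}(K), GSp_{2n}(𝒪); R) = R[T_{h_0}, …, T_{h_n}, T_{z⁻¹}]` over EVERY commutative ring `R`** (Andrianov–Zhuravlev:
the local Hecke ring of the symplectic group is generated by `T(p), T_1(p²), …, T_{n-1}(p²), [p]^{±1}`).
[cite: AndrianovZhuravlev1995, Ch. 3 §3.3 Thm. 3.30] [cite: CartierCorvallis1979, §IV Thm. 4.1] -/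
theorem adjoin_insert_doubleCosetOperator_gen_eq_top_similitude (hϖ : Valued.v ϖ = WithZero.exp (-1 : ℤ)) :
    Algebra.adjoin R (insert
        (heckeAlgebra.doubleCosetOperator (k := R) (symplecticSimilitudeInt (Fin n) K)
          (similitudeTorusElt (uniformizer_ne_zero hϖ) (-2) (fun _ : Fin n => (1 : ℤ)) : symplecticSimilitudeGroup (Fin n) K))
        (Set.range fun r : Fin (n + 1) => heckeAlgebra.doubleCosetOperator (k := R) (symplecticSimilitudeInt (Fin n) K)
            (similitudeTorusElt (uniformizer_ne_zero hϖ) (if (r : ℕ) + 1 = n then (1 : ℤ) else 2)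
              (fun i : Fin n => (if (i : ℕ) ≤ (r : ℕ) then (1 : ℤ) else 0) - (if (r : ℕ) = n then 2 else 1)) :
              symplecticSimilitudeGroup (Fin n) K))) = ⊤ := by
  refine eq_top_iff.2 fun T _ => ?_
  have hT := mem_span_doubleCosetOperator_dominant_similitude (R := R) hϖ T
  refine (Submodule.span_le (p := Subalgebra.toSubmodule (Algebra.adjoin R _))).2 ?_ hT
  rintro _ ⟨d, rfl⟩
  exact doubleCosetOperator_mem_adjoin_insert_similitude hϖ d.2.1 d.2.2

omit [NeZero n] in
/-- The last generator `h_n` is `z = t(2; -1)`. [folklore] -/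
private theorem doubleCosetOperator_gen_last (hϖ : Valued.v ϖ = WithZero.exp (-1 : ℤ)) :
    (fun r : Fin (n + 1) => heckeAlgebra.doubleCosetOperator (k := R) (symplecticSimilitudeInt (Fin n) K)
            (similitudeTorusElt (uniformizer_ne_zero hϖ) (if (r : ℕ) + 1 = n then (1 : ℤ) else 2)
              (fun i : Fin n => (if (i : ℕ) ≤ (r : ℕ) then (1 : ℤ) else 0) - (if (r : ℕ) = n then 2 else 1)) :
              symplecticSimilitudeGroup (Fin n) K)) (Fin.last n) =
      heckeAlgebra.doubleCosetOperator (k := R) (symplecticSimilitudeInt (Fin n) K)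
        (similitudeTorusElt (uniformizer_ne_zero hϖ) 2 (fun _ : Fin n => (-1 : ℤ)) : symplecticSimilitudeGroup (Fin n) K) := by
  refine doubleCosetOperator_torusElt_congr hϖ (by rw [if_neg (by rw [Fin.val_last]; omega)]) (funext fun i => ?_)
  have hi := i.isLt
  simp only [Fin.val_last]
  split_ifs <;> omega

/-! ## §6 THE STRUCTURE THEOREM `ℋ(GSp_{2n}(K), GSp_{2n}(𝒪); R) ≅ R[X_0, …, X_n][X_n⁻¹]` and its corollaries -/

set_option maxHeartbeats 1600000 in
/-- **STRUCTURE THEOREM (Satake; Andrianov–Zhuravlev Thm. 3.30; Cartier Thm. 4.1 — over ANY commutative ring):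
`ℋ(GSp_{2n}(K), GSp_{2n}(𝒪); R) ≃ₐ[R] R[X_0, …, X_n][X_n⁻¹]`** (the localization of `MvPolynomial (Fin (n+1)) R` away from
`X_n`), the inverse sending `X_r ↦ T_{h_r}` (`h_r = t(2; 1^{r+1} 0^{n-r-1} - 1)` for `r ≤ n - 2`, `h_{n-1} = diag(ϖ 1_n; 1_n)`,
`h_n = z = ϖ·1`) and `X_n⁻¹ ↦ T_{z⁻¹}`. [cite: AndrianovZhuravlev1995, Ch. 3 §3.3 Thm. 3.30] [cite: CartierCorvallis1979, §IV Thm. 4.1]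
[cite: Macdonald1995, Ch. V (2.5), (2.7)] -/
theorem exists_algEquiv_heckeAlgebra_symplecticSimilitudeInt_localization (hϖ : Valued.v ϖ = WithZero.exp (-1 : ℤ)) :
    ∃ e : heckeAlgebra R (symplecticSimilitudeGroup (Fin n) K) (symplecticSimilitudeInt (Fin n) K) ≃ₐ[R]
        Localization.Away (MvPolynomial.X (Fin.last n) : MvPolynomial (Fin (n + 1)) R),
      (∀ r : Fin (n + 1), e.symm (algebraMap (MvPolynomial (Fin (n + 1)) R)
          (Localization.Away (MvPolynomial.X (Fin.last n) : MvPolynomial (Fin (n + 1)) R)) (MvPolynomial.X r)) = heckeAlgebra.doubleCosetOperator (k := R) (symplecticSimilitudeInt (Fin n) K)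
            (similitudeTorusElt (uniformizer_ne_zero hϖ) (if (r : ℕ) + 1 = n then (1 : ℤ) else 2)
              (fun i : Fin n => (if (i : ℕ) ≤ (r : ℕ) then (1 : ℤ) else 0) - (if (r : ℕ) = n then 2 else 1)) :
              symplecticSimilitudeGroup (Fin n) K)) ∧
      e.symm (IsLocalization.Away.invSelf (MvPolynomial.X (Fin.last n) : MvPolynomial (Fin (n + 1)) R)) =
        heckeAlgebra.doubleCosetOperator (k := R) (symplecticSimilitudeInt (Fin n) K)
          (similitudeTorusElt (uniformizer_ne_zero hϖ) (-2) (fun _ : Fin n => (1 : ℤ)) : symplecticSimilitudeGroup (Fin n) K) := by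
  classical
  haveI := isMulCommutative_heckeAlgebra_symplecticSimilitudeInt (n := n) hϖ R
  letI : CommSemiring (heckeAlgebra R (symplecticSimilitudeGroup (Fin n) K) (symplecticSimilitudeInt (Fin n) K)) :=
    { (inferInstance : Semiring (heckeAlgebra R (symplecticSimilitudeGroup (Fin n) K) (symplecticSimilitudeInt (Fin n) K))) with
      mul_comm := fun a b => IsMulCommutative.is_comm.comm a b }
  -- the evaluation `φ : R[X] → ℋ`, `X_r ↦ T_{h_r}`; injective by the linear independence of ordered monomials
  set φ := MvPolynomial.aeval (R := R) (fun r : Fin (n + 1) => heckeAlgebra.doubleCosetOperator (k := R) (symplecticSimilitudeInt (Fin n) K)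
            (similitudeTorusElt (uniformizer_ne_zero hϖ) (if (r : ℕ) + 1 = n then (1 : ℤ) else 2)
              (fun i : Fin n => (if (i : ℕ) ≤ (r : ℕ) then (1 : ℤ) else 0) - (if (r : ℕ) = n then 2 else 1)) :
              symplecticSimilitudeGroup (Fin n) K)) with hφ
  have hφX : ∀ r : Fin (n + 1), φ (MvPolynomial.X r) = heckeAlgebra.doubleCosetOperator (k := R) (symplecticSimilitudeInt (Fin n) K)
            (similitudeTorusElt (uniformizer_ne_zero hϖ) (if (r : ℕ) + 1 = n then (1 : ℤ) else 2)
              (fun i : Fin n => (if (i : ℕ) ≤ (r : ℕ) then (1 : ℤ) else 0) - (if (r : ℕ) = n then 2 else 1)) :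
              symplecticSimilitudeGroup (Fin n) K) := fun r => by
    rw [hφ, MvPolynomial.aeval_X]
  have hφinj : Function.Injective φ := by
    rw [injective_iff_map_eq_zero]
    intro P hP
    have hlin := (linearIndependent_monomials_similitude (n := n) (R := R) hϖ).comp
      (fun d : Fin (n + 1) →₀ ℕ => (d : Fin (n + 1) → ℕ)) DFunLike.coe_injective
    have hzero := linearIndependent_iff'ₛ.1 hlin P.support (fun d => P.coeff d) (fun _ => 0) (by
      simp only [Function.comp_apply, zero_smul, Finset.sum_const_zero]
      rw [hφ, MvPolynomial.aeval_def, MvPolynomial.eval₂_eq'] at hP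
      rw [← hP]
      refine Finset.sum_congr rfl fun d _ => ?_
      rw [Algebra.smul_def, List.prod_ofFn])
    ext d
    rw [MvPolynomial.coeff_zero]
    by_cases hd : d ∈ P.support
    · exact hzero d hd
    · exact MvPolynomial.notMem_support_iff.1 hd
  -- `X_n ↦ T_z`, a unit with inverse `T_{z⁻¹}`
  have hEπ : φ (MvPolynomial.X (Fin.last n)) = heckeAlgebra.doubleCosetOperator (k := R) (symplecticSimilitudeInt (Fin n) K)
      (similitudeTorusElt (uniformizer_ne_zero hϖ) 2 (fun _ : Fin n => (-1 : ℤ)) : symplecticSimilitudeGroup (Fin n) K) := by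
    rw [hφX]
    exact doubleCosetOperator_gen_last (R := R) hϖ
  set ψ : Localization.Away (MvPolynomial.X (Fin.last n) : MvPolynomial (Fin (n + 1)) R) →ₐ[R]
      heckeAlgebra R (symplecticSimilitudeGroup (Fin n) K) (symplecticSimilitudeInt (Fin n) K) :=
    IsLocalization.Away.liftAlgHom (MvPolynomial.X (Fin.last n) : MvPolynomial (Fin (n + 1)) R) (f := φ) (isUnit_iff_exists.2
      ⟨heckeAlgebra.doubleCosetOperator (k := R) (symplecticSimilitudeInt (Fin n) K)
        (similitudeTorusElt (uniformizer_ne_zero hϖ) (-2) (fun _ : Fin n => (1 : ℤ)) : symplecticSimilitudeGroup (Fin n) K), by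
        rw [hEπ]
        exact ⟨doubleCosetOperator_z_mul_zinv hϖ, doubleCosetOperator_zinv_mul_z hϖ⟩⟩) with hψ
  have hψalg : ∀ x : MvPolynomial (Fin (n + 1)) R, ψ (algebraMap (MvPolynomial (Fin (n + 1)) R)
      (Localization.Away (MvPolynomial.X (Fin.last n) : MvPolynomial (Fin (n + 1)) R)) x) = φ x := fun x => by
    rw [hψ, IsLocalization.Away.liftAlgHom_apply, IsLocalization.Away.lift_eq]
    rfl
  -- `ψ` is injective
  have hinj : Function.Injective ψ := by
    rintro z₁ z₂ hz
    obtain ⟨⟨a₁, s₁⟩, rfl⟩ := IsLocalization.mk'_surjective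
      (Submonoid.powers (MvPolynomial.X (Fin.last n) : MvPolynomial (Fin (n + 1)) R)) z₁
    obtain ⟨⟨a₂, s₂⟩, rfl⟩ := IsLocalization.mk'_surjective
      (Submonoid.powers (MvPolynomial.X (Fin.last n) : MvPolynomial (Fin (n + 1)) R)) z₂
    have h₁ := IsLocalization.mk'_spec (Localization.Away (MvPolynomial.X (Fin.last n) : MvPolynomial (Fin (n + 1)) R)) a₁ s₁
    have h₂ := IsLocalization.mk'_spec (Localization.Away (MvPolynomial.X (Fin.last n) : MvPolynomial (Fin (n + 1)) R)) a₂ s₂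
    refine IsLocalization.mk'_eq_of_eq (hφinj ?_)
    have e₁ : φ a₁ = ψ (IsLocalization.mk' (Localization.Away (MvPolynomial.X (Fin.last n) : MvPolynomial (Fin (n + 1)) R)) a₁ s₁) *
        φ (s₁ : MvPolynomial (Fin (n + 1)) R) := by
      rw [← hψalg, ← h₁, map_mul, hψalg]
    have e₂ : φ a₂ = ψ (IsLocalization.mk' (Localization.Away (MvPolynomial.X (Fin.last n) : MvPolynomial (Fin (n + 1)) R)) a₂ s₂) *
        φ (s₂ : MvPolynomial (Fin (n + 1)) R) := by
      rw [← hψalg, ← h₂, map_mul, hψalg]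
    simp only at hz
    rw [map_mul, map_mul, e₁, e₂, hz, mul_left_comm (φ (s₁ : MvPolynomial (Fin (n + 1)) R)),
      mul_left_comm (φ (s₂ : MvPolynomial (Fin (n + 1)) R)), mul_comm (φ (s₁ : MvPolynomial (Fin (n + 1)) R))]
  -- `ψ` is surjective: the generators `T_{h_r}` and `T_{z⁻¹}` of `ℋ` are hit
  have hψinv : ψ (IsLocalization.Away.invSelf (MvPolynomial.X (Fin.last n) : MvPolynomial (Fin (n + 1)) R)) =
      heckeAlgebra.doubleCosetOperator (k := R) (symplecticSimilitudeInt (Fin n) K)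
        (similitudeTorusElt (uniformizer_ne_zero hϖ) (-2) (fun _ : Fin n => (1 : ℤ)) : symplecticSimilitudeGroup (Fin n) K) := by
    have h3 : heckeAlgebra.doubleCosetOperator (k := R) (symplecticSimilitudeInt (Fin n) K)
          (similitudeTorusElt (uniformizer_ne_zero hϖ) 2 (fun _ : Fin n => (-1 : ℤ)) : symplecticSimilitudeGroup (Fin n) K) *
        ψ (IsLocalization.Away.invSelf (MvPolynomial.X (Fin.last n) : MvPolynomial (Fin (n + 1)) R)) = 1 := by
      rw [← hEπ, ← hψalg, ← map_mul, IsLocalization.Away.mul_invSelf, map_one]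
    calc ψ (IsLocalization.Away.invSelf (MvPolynomial.X (Fin.last n) : MvPolynomial (Fin (n + 1)) R))
        = heckeAlgebra.doubleCosetOperator (k := R) (symplecticSimilitudeInt (Fin n) K)
              (similitudeTorusElt (uniformizer_ne_zero hϖ) (-2) (fun _ : Fin n => (1 : ℤ)) : symplecticSimilitudeGroup (Fin n) K) *
            heckeAlgebra.doubleCosetOperator (k := R) (symplecticSimilitudeInt (Fin n) K)
              (similitudeTorusElt (uniformizer_ne_zero hϖ) 2 (fun _ : Fin n => (-1 : ℤ)) : symplecticSimilitudeGroup (Fin n) K) *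
            ψ (IsLocalization.Away.invSelf (MvPolynomial.X (Fin.last n) : MvPolynomial (Fin (n + 1)) R)) := by
          rw [doubleCosetOperator_zinv_mul_z hϖ, one_mul]
      _ = _ := by rw [mul_assoc, h3, mul_one]
  have hrange : ψ.range = ⊤ := by
    rw [← Algebra.map_top, ← adjoin_insert_invSelf_range_eq_top_of_commRing (n := n + 1) (R := R) (Fin.last n), AlgHom.map_adjoin,
      Set.image_insert_eq, ← Set.range_comp, hψinv]
    have h2 : (ψ ∘ fun r : Fin (n + 1) => algebraMap (MvPolynomial (Fin (n + 1)) R)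
        (Localization.Away (MvPolynomial.X (Fin.last n) : MvPolynomial (Fin (n + 1)) R)) (MvPolynomial.X r)) =
        fun r : Fin (n + 1) => heckeAlgebra.doubleCosetOperator (k := R) (symplecticSimilitudeInt (Fin n) K)
            (similitudeTorusElt (uniformizer_ne_zero hϖ) (if (r : ℕ) + 1 = n then (1 : ℤ) else 2)
              (fun i : Fin n => (if (i : ℕ) ≤ (r : ℕ) then (1 : ℤ) else 0) - (if (r : ℕ) = n then 2 else 1)) :
              symplecticSimilitudeGroup (Fin n) K) := funext fun r => by
      rw [Function.comp_apply, hψalg, hφX]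
    rw [h2]
    exact adjoin_insert_doubleCosetOperator_gen_eq_top_similitude hϖ
  have hsurj : Function.Surjective ψ := (AlgHom.range_eq_top ψ).1 hrange
  refine ⟨(AlgEquiv.ofBijective ψ ⟨hinj, hsurj⟩).symm, fun r => ?_, ?_⟩
  · rw [AlgEquiv.symm_symm, AlgEquiv.ofBijective_apply, hψalg, hφX]
  · rw [AlgEquiv.symm_symm, AlgEquiv.ofBijective_apply, hψinv]

/-- **`ℋ(GSp_{2n}(K), GSp_{2n}(𝒪); R)` is an integral domain whenever `R` is** («the local Hecke ring of the symplectic group has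
no zero divisors»). [cite: AndrianovZhuravlev1995, Ch. 3 §3.3 Thm. 3.30] -/
theorem isDomain_heckeAlgebra_symplecticSimilitudeInt_of_isDomain [IsDomain R] (hϖ : Valued.v ϖ = WithZero.exp (-1 : ℤ)) :
    IsDomain (heckeAlgebra R (symplecticSimilitudeGroup (Fin n) K) (symplecticSimilitudeInt (Fin n) K)) := by
  obtain ⟨e, -⟩ := exists_algEquiv_heckeAlgebra_symplecticSimilitudeInt_localization (n := n) (R := R) hϖ
  haveI : IsDomain (Localization.Away (MvPolynomial.X (Fin.last n) : MvPolynomial (Fin (n + 1)) R)) :=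
    IsLocalization.isDomain_localization (powers_le_nonZeroDivisors_of_noZeroDivisors (MvPolynomial.X_ne_zero _))
  exact MulEquiv.isDomain _ e.toMulEquiv

/-- **UNRAMIFIED CHARACTERS: `Hom_{R-alg}(ℋ(GSp_{2n}(K), GSp_{2n}(𝒪); R), A) ≃ {t ∈ A^{n+1} : t_n ∈ Aˣ}`**, `χ ↦ (χ(T_{h_r}))_r`,
for every commutative `R`-algebra `A` (the Satake parameters of an unramified representation of `GSp_{2n}`: `n + 1` coordinates,
the last one — the central character at `ϖ` — invertible). [cite: CartierCorvallis1979, §IV Thm. 4.1, Cor. 4.2]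
[cite: AndrianovZhuravlev1995, Ch. 3 §3.3 Thm. 3.30] [cite: Macdonald1995, Ch. V §3 (3.2)] -/
theorem exists_equiv_algHom_heckeAlgebra_symplecticSimilitudeInt (hϖ : Valued.v ϖ = WithZero.exp (-1 : ℤ)) (A : Type*)
    [CommRing A] [Algebra R A] :
    ∃ ε : (heckeAlgebra R (symplecticSimilitudeGroup (Fin n) K) (symplecticSimilitudeInt (Fin n) K) →ₐ[R] A) ≃
        {t : Fin (n + 1) → A // IsUnit (t (Fin.last n))},
      ∀ χ r, (ε χ).1 r = χ (heckeAlgebra.doubleCosetOperator (k := R) (symplecticSimilitudeInt (Fin n) K)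
            (similitudeTorusElt (uniformizer_ne_zero hϖ) (if (r : ℕ) + 1 = n then (1 : ℤ) else 2)
              (fun i : Fin n => (if (i : ℕ) ≤ (r : ℕ) then (1 : ℤ) else 0) - (if (r : ℕ) = n then 2 else 1)) :
              symplecticSimilitudeGroup (Fin n) K)) := by
  obtain ⟨e, he, -⟩ := exists_algEquiv_heckeAlgebra_symplecticSimilitudeInt_localization (n := n) (R := R) hϖ
  obtain ⟨ε₀, hε₀⟩ := exists_equiv_algHom_localization_mvPolynomial_of_commRing (R := R) (A := A) (n := n + 1) (Fin.last n)
  refine ⟨(Equiv.mk (fun χ => χ.comp (e.symm : _ →ₐ[R] _)) (fun ψ => ψ.comp (e : _ →ₐ[R] _))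
      (fun χ => by ext x; simp) (fun ψ => by ext x; simp)).trans ε₀, fun χ r => ?_⟩
  show (ε₀ (χ.comp (e.symm : _ →ₐ[R] _))).1 r = _
  rw [hε₀, AlgHom.comp_apply, AlgEquiv.coe_toAlgHom, he]

/-- **An `R`-algebra map out of `ℋ(GSp_{2n}(K), GSp_{2n}(𝒪); R)` is determined by its values on the `T_{h_r}`** (the value on
`T_{z⁻¹}` is forced as the two-sided inverse of the value on `T_{h_n} = T_z`).
[cite: AndrianovZhuravlev1995, Ch. 3 §3.3 Thm. 3.30] [cite: CartierCorvallis1979, §IV Cor. 4.2] -/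
theorem algHom_heckeAlgebra_symplecticSimilitudeInt_ext (hϖ : Valued.v ϖ = WithZero.exp (-1 : ℤ)) {B : Type*} [Semiring B]
    [Algebra R B] {χ₁ χ₂ : heckeAlgebra R (symplecticSimilitudeGroup (Fin n) K) (symplecticSimilitudeInt (Fin n) K) →ₐ[R] B}
    (h : ∀ r : Fin (n + 1), χ₁ (heckeAlgebra.doubleCosetOperator (k := R) (symplecticSimilitudeInt (Fin n) K)
            (similitudeTorusElt (uniformizer_ne_zero hϖ) (if (r : ℕ) + 1 = n then (1 : ℤ) else 2)
              (fun i : Fin n => (if (i : ℕ) ≤ (r : ℕ) then (1 : ℤ) else 0) - (if (r : ℕ) = n then 2 else 1)) :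
              symplecticSimilitudeGroup (Fin n) K)) = χ₂ (heckeAlgebra.doubleCosetOperator (k := R) (symplecticSimilitudeInt (Fin n) K)
            (similitudeTorusElt (uniformizer_ne_zero hϖ) (if (r : ℕ) + 1 = n then (1 : ℤ) else 2)
              (fun i : Fin n => (if (i : ℕ) ≤ (r : ℕ) then (1 : ℤ) else 0) - (if (r : ℕ) = n then 2 else 1)) :
              symplecticSimilitudeGroup (Fin n) K))) : χ₁ = χ₂ := by
  refine AlgHom.ext_of_adjoin_eq_top (adjoin_insert_doubleCosetOperator_gen_eq_top_similitude (R := R) hϖ) ?_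
  rintro x (rfl | ⟨r, rfl⟩)
  · have hz : χ₁ (heckeAlgebra.doubleCosetOperator (k := R) (symplecticSimilitudeInt (Fin n) K)
          (similitudeTorusElt (uniformizer_ne_zero hϖ) 2 (fun _ : Fin n => (-1 : ℤ)) : symplecticSimilitudeGroup (Fin n) K)) =
        χ₂ (heckeAlgebra.doubleCosetOperator (k := R) (symplecticSimilitudeInt (Fin n) K)
          (similitudeTorusElt (uniformizer_ne_zero hϖ) 2 (fun _ : Fin n => (-1 : ℤ)) : symplecticSimilitudeGroup (Fin n) K)) := by
      rw [← doubleCosetOperator_gen_last (R := R) hϖ]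
      exact h (Fin.last n)
    have h1 : χ₁ (heckeAlgebra.doubleCosetOperator (k := R) (symplecticSimilitudeInt (Fin n) K)
          (similitudeTorusElt (uniformizer_ne_zero hϖ) (-2) (fun _ : Fin n => (1 : ℤ)) : symplecticSimilitudeGroup (Fin n) K)) *
        χ₂ (heckeAlgebra.doubleCosetOperator (k := R) (symplecticSimilitudeInt (Fin n) K)
          (similitudeTorusElt (uniformizer_ne_zero hϖ) 2 (fun _ : Fin n => (-1 : ℤ)) : symplecticSimilitudeGroup (Fin n) K)) = 1 := by
      rw [← hz, ← map_mul, doubleCosetOperator_zinv_mul_z hϖ, map_one]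
    have h2 : χ₂ (heckeAlgebra.doubleCosetOperator (k := R) (symplecticSimilitudeInt (Fin n) K)
          (similitudeTorusElt (uniformizer_ne_zero hϖ) 2 (fun _ : Fin n => (-1 : ℤ)) : symplecticSimilitudeGroup (Fin n) K)) *
        χ₂ (heckeAlgebra.doubleCosetOperator (k := R) (symplecticSimilitudeInt (Fin n) K)
          (similitudeTorusElt (uniformizer_ne_zero hϖ) (-2) (fun _ : Fin n => (1 : ℤ)) : symplecticSimilitudeGroup (Fin n) K)) = 1 := by
      rw [← map_mul, doubleCosetOperator_z_mul_zinv hϖ, map_one]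
    exact left_inv_eq_right_inv h1 h2
  · exact h r

end Literature.NumberTheory.Automorphic.SymplecticCartan

end
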